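import Mathlib
import Summits.ValiantsHypothesis.ValiantsHypothesis.Theorems.DivisionGapPerMultiplesHardStubDenseRegularPair
import Summits.ValiantsHypothesis.ValiantsHypothesis.Theorems.DivisionGapPerMultiplesHardStubRegularPairClean
import Summits.ValiantsHypothesis.ValiantsHypothesis.Theorems.DivisionGapPerMultiplesHardStubCodegreeDeviation
import Summits.ValiantsHypothesis.ValiantsHypothesis.Theorems.DivisionGapPerMultiplesHardStubMatchingGlue
import Summits.ValiantsHypothesis.ValiantsHypothesis.Theorems.DivisionGapPerMultiplesHardStubCodegreeMixing
import Summits.ValiantsHypothesis.ValiantsHypothesis.Theorems.DivisionGapPerMultiplesHardRichPiece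

/-!
# `DivisionGap.PerMultiplesHard` (stmt-ValiantsHypothesis-5068), line `uncharged-face-walk`:
the EXTRACTION `stub_quasiRandomSquareBlock` (lead c9, cycle 9) — composition

A RICH host `G ⊆ [n]²` (`n! ≤ Kⁿ·#PM(G)`) has a LINEAR σ-SQUARE QUASI-RANDOM BLOCK: chain the rich piece
(`stub_richPiece`: an extendable σ₀-square sub-board with linear minimum degrees), Szemerédi (`stub_denseRegularPair`:
a dense ε-regular balanced pair below the extendability scale), the cleaning `stub_regularPairClean` ((H1), (H3), a
matching of the block), a transport of the block to the `a`-board, `stub_codegreeDeviation` ((H2)) and the Hall-surplus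
completion `stub_matchingGlue` (i) of the block matching to a perfect matching `σ ⊆ G` with `σ(B) = A`.  The composition
is `quasiRandomSquareBlock_of_richPiece` (rich piece as a hypothesis) and the registered stub `stub_quasiRandomSquareBlock` is its
instance at `RichPiece.stub_richPiece`; the transport lemmas (`card_filter_transport`, `rect_transport`) are the only new
ingredients. Elementary. [folklore]
-/

noncomputable section

-- `Summit.ValiantsHypothesis.ValiantsHypothesis.…` is the tree's mandated layout (Sub = Summit).
set_option linter.dupNamespace false

open Finset
open scoped BigOperators

namespace Summit.ValiantsHypothesis.ValiantsHypothesis.Theorems.DivisionGap.PerMultiplesHard.Extraction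

/-! ### Transport of a block `A × B ⊆ [n]²` to the `a`-board -/

/-- Counting through an enumeration: for `e : Fin a ≃ S` and a predicate `Q` on `Fin n`,
`#{y : Fin a | Q (e y)} = #{j ∈ S | Q j}`. -/
theorem card_filter_transport {n a : ℕ} (S : Finset (Fin n)) (e : Fin a ≃ {x // x ∈ S}) (Q : Fin n → Prop)
    [DecidablePred Q] :
    (Finset.univ.filter fun y : Fin a => Q ((e y : Fin n))).card = (S.filter fun j => Q j).card := by
  classical
  refine Finset.card_bij (fun y _ => ((e y : Fin n))) ?_ ?_ ?_
  · intro y hy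
    simp only [Finset.mem_filter, Finset.mem_univ, true_and] at hy
    exact Finset.mem_filter.mpr ⟨(e y).2, hy⟩
  · intro y₁ _ y₂ _ h
    exact e.injective (Subtype.ext h)
  · intro j hj
    rw [Finset.mem_filter] at hj
    refine ⟨e.symm ⟨j, hj.1⟩, ?_, ?_⟩
    · simp only [Finset.mem_filter, Finset.mem_univ, true_and, Equiv.apply_symm_apply]
      exact hj.2
    · simp only [Equiv.apply_symm_apply]

/-- Transport of rectangle edge counts: for enumerations `eA : Fin a ≃ A`, `eB : Fin a ≃ B` and the transported graph
`X' = {(x,y) : (eA x, eB y) ∈ X}`, `e_{X'}(S, T) = e_X(eA(S), eB(T))`. -/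
theorem rect_transport {n a : ℕ} (X : Finset (Fin n × Fin n)) (A B : Finset (Fin n))
    (eA : Fin a ≃ {x // x ∈ A}) (eB : Fin a ≃ {x // x ∈ B}) (X' : Finset (Fin a × Fin a))
    (hX' : ∀ e : Fin a × Fin a, e ∈ X' ↔ (((eA e.1 : Fin n)), ((eB e.2 : Fin n))) ∈ X)
    (S T : Finset (Fin a)) :
    (X'.filter fun e => e.1 ∈ S ∧ e.2 ∈ T).card =
      (X.filter fun e => e.1 ∈ S.map ⟨fun x => ((eA x : Fin n)), fun _ _ h => eA.injective (Subtype.ext h)⟩ ∧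
        e.2 ∈ T.map ⟨fun y => ((eB y : Fin n)), fun _ _ h => eB.injective (Subtype.ext h)⟩).card := by
  classical
  refine Finset.card_bij (fun e _ => ((((eA e.1 : Fin n)), ((eB e.2 : Fin n))) : Fin n × Fin n)) ?_ ?_ ?_
  · intro e he
    rw [Finset.mem_filter] at he ⊢
    refine ⟨(hX' e).mp he.1, ?_, ?_⟩
    · exact Finset.mem_map.mpr ⟨e.1, he.2.1, rfl⟩
    · exact Finset.mem_map.mpr ⟨e.2, he.2.2, rfl⟩
  · intro e₁ _ e₂ _ h
    simp only [Prod.mk.injEq] at h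
    exact Prod.ext (eA.injective (Subtype.ext h.1)) (eB.injective (Subtype.ext h.2))
  · intro f hf
    rw [Finset.mem_filter] at hf
    obtain ⟨hfX, hf1, hf2⟩ := hf
    obtain ⟨x, hx, hxe⟩ := Finset.mem_map.mp hf1
    obtain ⟨y, hy, hye⟩ := Finset.mem_map.mp hf2
    refine ⟨(x, y), ?_, ?_⟩
    · rw [Finset.mem_filter]
      refine ⟨(hX' (x, y)).mpr ?_, hx, hy⟩
      have : f = ((((eA x : Fin n)), ((eB y : Fin n))) : Fin n × Fin n) :=
        Prod.ext hxe.symm hye.symm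
      rw [← this]; exact hfX
    · exact Prod.ext hxe hye

/-- The full image of an enumeration is the enumerated set. -/
theorem map_univ_equiv {n a : ℕ} (S : Finset (Fin n)) (e : Fin a ≃ {x // x ∈ S}) :
    (Finset.univ : Finset (Fin a)).map ⟨fun x => ((e x : Fin n)), fun _ _ h => e.injective (Subtype.ext h)⟩ = S := by
  ext j
  simp only [Finset.mem_map, Finset.mem_univ, true_and, Function.Embedding.coeFn_mk]
  constructor
  · rintro ⟨x, rfl⟩; exact (e x).2
  · intro hj; exact ⟨e.symm ⟨j, hj⟩, by simp⟩


/-! ### The composition -/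

/-- **The extraction, from the rich piece.**  If every rich host has an extendable σ₀-square sub-board with linear minimum
degrees (the statement of `RichPiece.stub_richPiece`), then every rich host has a linear σ-square QUASI-RANDOM block with
minimum degrees — the registered `stub_quasiRandomSquareBlock` of the skeleton, verbatim as conclusion.  Chain:
rich piece `(R, C, σ₀, s)` → `X := G ∩ (R × C)` is dense (`n² ≤ 4K·CA²·#X`) → `stub_denseRegularPair` (balanced dense
`1/P`-regular pair `(V, W)` of size `m ≤ s`) → `stub_regularPairClean` (`A ⊆ V`, `B ⊆ W`, `#A = #B = a ≥ m/16`, (H1), (H3),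
a matching `g`, density, regularity at level `P/16`) → transport to the `a`-board (`card_filter_transport`, `rect_transport`)
→ `stub_codegreeDeviation` ((H2), `c₂`, `c₄`) → `stub_matchingGlue` (i) (surplus `s ≥ a`) gives `σ ⊆ G` with `σ(B) = A`.
[folklore] -/
theorem quasiRandomSquareBlock_of_richPiece
    (hRP : ∀ K : ℕ, 1 ≤ K → ∃ CA n₀ : ℕ, 1 ≤ CA ∧ ∀ n ≥ n₀, ∀ G : Finset (Fin n × Fin n),
      n.factorial ≤ K ^ n * ((Finset.univ : Finset (Equiv.Perm (Fin n))).filter (fun σ => ∀ i, (σ i, i) ∈ G)).card →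
      ∃ (nn s : ℕ) (R C : Finset (Fin n)) (σ₀ : Equiv.Perm (Fin n)),
        R.card = nn ∧ C.card = nn ∧ n ≤ CA * nn ∧ nn ≤ 2048 * K ^ 2 * s ∧ s < nn ∧
        (∀ i, (σ₀ i, i) ∈ G) ∧ (∀ i, σ₀ i ∈ R ↔ i ∈ C) ∧
        (∀ x ∈ R, nn ≤ 4 * K * (C.filter fun j => (x, j) ∈ G).card) ∧
        (∀ y ∈ C, nn ≤ 4 * K * (R.filter fun i => (i, y) ∈ G).card) ∧
        (∀ U ⊆ R, U.Nonempty → U.card + s ≤ nn →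
          U.card + s ≤ (C.filter fun j => ∃ r ∈ U, (r, j) ∈ G).card)) :
    ∀ K : ℕ, 1 ≤ K → ∃ D₁ D₂ : ℕ, 1 ≤ D₁ ∧ 1 ≤ D₂ ∧ ∀ D₃ E : ℕ, 1 ≤ D₃ → 1 ≤ E →
      ∃ Cf n₀ : ℕ, 1 ≤ Cf ∧ ∀ n ≥ n₀, ∀ G : Finset (Fin n × Fin n),
      n.factorial ≤ K ^ n * ((Finset.univ : Finset (Equiv.Perm (Fin n))).filter (fun σ => ∀ i, (σ i, i) ∈ G)).card →
      ∃ (a : ℕ) (A B : Finset (Fin n)) (eA : Fin a ≃ {x // x ∈ A}) (eB : Fin a ≃ {x // x ∈ B})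
        (σ : Equiv.Perm (Fin n)) (X : Finset (Fin a × Fin a)) (c₂ c₄ : ℕ),
        n ≤ Cf * a ∧ (∀ i, (σ i, i) ∈ G) ∧ (∀ i, σ i ∈ A ↔ i ∈ B) ∧
        (∀ e : Fin a × Fin a, e ∈ X ↔ ((eA e.1 : Fin n), (eB e.2 : Fin n)) ∈ G) ∧
        (∀ x : Fin a, a ≤ D₁ * (Finset.univ.filter fun y : Fin a => (x, y) ∈ X).card) ∧
        (∀ y : Fin a, a ≤ D₁ * (Finset.univ.filter fun x : Fin a => (x, y) ∈ X).card) ∧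
        a ≤ D₂ * c₂ ∧ c₂ ≤ a ∧
        (D₃ : ℝ) * (∑ x : Fin a, ∑ x' ∈ Finset.univ.erase x,
            |(((Finset.univ.filter fun y : Fin a => (x, y) ∈ X ∧ (x', y) ∈ X).card : ℕ) : ℝ) - c₂|) ≤ (a : ℝ) ^ 3 ∧
        (D₃ : ℝ) * (∑ x₁ : Fin a, ∑ x₂ ∈ Finset.univ.erase x₁, ∑ x₃ ∈ (Finset.univ.erase x₁).erase x₂,
            ∑ x₄ ∈ ((Finset.univ.erase x₁).erase x₂).erase x₃,
            |(((Finset.univ.filter fun y : Fin a =>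
                (x₁, y) ∈ X ∧ (x₂, y) ∈ X ∧ (x₃, y) ∈ X ∧ (x₄, y) ∈ X).card : ℕ) : ℝ) - c₄|) ≤ (a : ℝ) ^ 5 ∧
        (D₃ : ℝ) * |(c₄ : ℝ) * a - (c₂ : ℝ) ^ 2| ≤ (a : ℝ) ^ 2 ∧
        (∀ x : Fin a, E * (Finset.univ.filter fun y : Fin a => y ≠ x ∧
            (Finset.univ.filter fun z : Fin a => (x, z) ∈ X ∧ (y, z) ∈ X).card < a / D₂).card ≤ a) := by
  classical
  intro K hK
  obtain ⟨CA, n₁, hCA, hRP⟩ := hRP K hK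
  -- constants depending on K only
  set D : ℕ := 4 * K * CA ^ 2 with hD
  set Cc : ℕ := 2048 * K ^ 2 * CA with hCc
  set Dd : ℕ := 256 * D with hDd
  have hD1 : 1 ≤ D := by rw [hD]; exact Nat.one_le_iff_ne_zero.mpr (by positivity)
  have hCc1 : 1 ≤ Cc := by rw [hCc]; exact Nat.one_le_iff_ne_zero.mpr (by positivity)
  have hDd1 : 1 ≤ Dd := by rw [hDd]; omega
  refine ⟨4 * Dd, 64 * Dd ^ 2, by omega, Nat.one_le_iff_ne_zero.mpr (by positivity), ?_⟩
  intro D₃ E hD₃ hE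
  obtain ⟨P₀, m₀, hRPC⟩ := RegularPairClean.stub_regularPairClean Dd E hDd1 hE
  obtain ⟨P₄, a₀, hP₄, hCD⟩ := CodegreeDeviation.stub_codegreeDeviation (2 * Dd) D₃ (by omega) hD₃
  set P : ℕ := 16 * (P₀ + P₄ + 1) with hP
  have hP1 : 1 ≤ P := by rw [hP]; omega
  obtain ⟨Mz, N₀, hMz, hDRP⟩ := DenseRegularPair.stub_denseRegularPair D P Cc hD1 hP1 hCc1
  -- the size constants
  set Q : ℕ := m₀ + a₀ + 4 * Dd ^ 2 + 1 with hQ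
  refine ⟨16 * Mz, n₁ + N₀ + 16 * Mz * Q, by omega, ?_⟩
  intro n hn G hrich
  -- (1) the rich piece
  obtain ⟨nn, s, R, C, σ₀, hRnn, hCnn, hnCA, hnns, hsnn, hσ₀G, hσ₀sq, hrow, hcol, hsur⟩ := hRP n (by omega) G hrich
  -- (2) the sub-board as a bipartite graph on `Fin n`
  set X : Finset (Fin n × Fin n) := G.filter (fun e => e.1 ∈ R ∧ e.2 ∈ C) with hX
  have hXG : ∀ e, e ∈ X → e ∈ G := fun e he => (Finset.mem_filter.mp he).1
  have hXR : ∀ e, e ∈ X → e.1 ∈ R ∧ e.2 ∈ C := fun e he => (Finset.mem_filter.mp he).2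
  have hdensX : n ^ 2 ≤ D * X.card := by
    -- #X = Σ_{x ∈ R} deg_C(x) ≥ nn · nn/(4K)
    have hsum : X.card = ∑ x ∈ R, (C.filter fun j => (x, j) ∈ G).card := by
      have h1 : X = X.filter (fun e => e.1 ∈ R ∧ e.2 ∈ C) := by
        ext e; simp only [Finset.mem_filter, hX]; tauto
      rw [h1, CodegreeMixing.card_filter_rect_eq_sum_rows X R C]
      refine Finset.sum_congr rfl fun x hx => ?_
      congr 1; ext j
      simp only [Finset.mem_filter, hX]
      tauto
    have h2 : nn * nn ≤ 4 * K * X.card := by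
      rw [hsum, Finset.mul_sum]
      calc nn * nn = ∑ _x ∈ R, nn := by rw [Finset.sum_const, hRnn, smul_eq_mul]
        _ ≤ ∑ x ∈ R, 4 * K * (C.filter fun j => (x, j) ∈ G).card := Finset.sum_le_sum hrow
    calc n ^ 2 ≤ (CA * nn) ^ 2 := Nat.pow_le_pow_left hnCA 2
      _ = CA ^ 2 * (nn * nn) := by ring
      _ ≤ CA ^ 2 * (4 * K * X.card) := Nat.mul_le_mul_left _ h2
      _ = D * X.card := by rw [hD]; ring
  -- (3) a dense regular balanced pair
  obtain ⟨m, V, W, hV, hW, hnM, hCcm, hdens, hreg⟩ := hDRP n (by omega) X hdensX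
  -- sizes: m ≥ 16Q, m ≤ s
  have hm16 : 16 * Q ≤ m := by
    have : Mz * (16 * Q) ≤ Mz * m := by
      calc Mz * (16 * Q) = 16 * Mz * Q := by ring
        _ ≤ n := by omega
        _ ≤ Mz * m := hnM
    exact Nat.le_of_mul_le_mul_left this (by omega)
  have hms : m ≤ s := by
    -- Cc·m ≤ n ≤ CA·nn and nn ≤ 2048K²·s
    have h1 : 2048 * K ^ 2 * CA * m ≤ CA * nn := by rw [← hCc]; exact le_trans hCcm hnCA
    have h2 : 2048 * K ^ 2 * m ≤ nn := by
      have : CA * (2048 * K ^ 2 * m) ≤ CA * nn := by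
        calc CA * (2048 * K ^ 2 * m) = 2048 * K ^ 2 * CA * m := by ring
          _ ≤ CA * nn := h1
      exact Nat.le_of_mul_le_mul_left this (by omega)
    have h3 : 2048 * K ^ 2 * m ≤ 2048 * K ^ 2 * s := le_trans h2 hnns
    exact Nat.le_of_mul_le_mul_left h3 (by positivity)
  -- (4) cleaning
  have hdens' : m * m ≤ Dd * (X.filter fun e => e.1 ∈ V ∧ e.2 ∈ W).card := by rw [hDd]; exact hdens
  obtain ⟨a, A, B, g, hAV, hBW, hAa, hBa, ha1, hma, h1r, h1c, h3, hg1, hg2, hdAB, hregAB⟩ :=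
    hRPC n m P X V W (by rw [hP]; omega) hV hW (by omega) hdens' hreg
  have hP16 : P / 16 = P₀ + P₄ + 1 := by rw [hP]; omega
  rw [hP16] at hregAB
  have haQ : Q ≤ a := by omega
  have ha₀ : a₀ ≤ a := by omega
  have haDd : 4 * Dd ^ 2 + 1 ≤ a := by omega
  -- A ⊆ R, B ⊆ C
  have hAR : A ⊆ R := by
    intro x hx
    have h := h1r x hx
    have hpos : 0 < (B.filter fun y => (x, y) ∈ X).card := by
      by_contra h0
      push Not at h0
      have : (B.filter fun y => (x, y) ∈ X).card = 0 := by omega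
      rw [this, mul_zero] at h; omega
    obtain ⟨y, hy⟩ := Finset.card_pos.mp hpos
    exact (hXR _ (Finset.mem_filter.mp hy).2).1
  have hBC : B ⊆ C := by
    intro y hy
    have h := h1c y hy
    have hpos : 0 < (A.filter fun x => (x, y) ∈ X).card := by
      by_contra h0
      push Not at h0
      have : (A.filter fun x => (x, y) ∈ X).card = 0 := by omega
      rw [this, mul_zero] at h; omega
    obtain ⟨x, hx⟩ := Finset.card_pos.mp hpos
    exact (hXR _ (Finset.mem_filter.mp hx).2).2
  -- (5) transport to the `a`-board
  let eA : Fin a ≃ {x // x ∈ A} := (A.equivFin.trans (finCongr hAa)).symm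
  let eB : Fin a ≃ {x // x ∈ B} := (B.equivFin.trans (finCongr hBa)).symm
  let X' : Finset (Fin a × Fin a) := Finset.univ.filter fun e => (((eA e.1 : Fin n)), ((eB e.2 : Fin n))) ∈ X
  have hX' : ∀ e : Fin a × Fin a, e ∈ X' ↔ (((eA e.1 : Fin n)), ((eB e.2 : Fin n))) ∈ X := by
    intro e; simp only [X', Finset.mem_filter, Finset.mem_univ, true_and]
  have hX'G : ∀ e : Fin a × Fin a, e ∈ X' ↔ (((eA e.1 : Fin n)), ((eB e.2 : Fin n))) ∈ G := by
    intro e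
    rw [hX']
    constructor
    · exact hXG _
    · intro h
      exact Finset.mem_filter.mpr ⟨h, hAR (eA e.1).2, hBC (eB e.2).2⟩
  -- degrees, codegrees, rectangles
  have tRow : ∀ x : Fin a, (Finset.univ.filter fun y : Fin a => (x, y) ∈ X').card =
      (B.filter fun j => (((eA x : Fin n)), j) ∈ X).card := by
    intro x
    have := card_filter_transport B eB (fun j => (((eA x : Fin n)), j) ∈ X)
    refine Eq.trans ?_ this
    congr 1; ext y; simp only [Finset.mem_filter, Finset.mem_univ, true_and, hX']
  have tCol : ∀ y : Fin a, (Finset.univ.filter fun x : Fin a => (x, y) ∈ X').card =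
      (A.filter fun i => (i, ((eB y : Fin n))) ∈ X).card := by
    intro y
    have := card_filter_transport A eA (fun i => (i, ((eB y : Fin n))) ∈ X)
    refine Eq.trans ?_ this
    congr 1; ext x; simp only [Finset.mem_filter, Finset.mem_univ, true_and, hX']
  have tCodeg : ∀ x x' : Fin a, (Finset.univ.filter fun z : Fin a => (x, z) ∈ X' ∧ (x', z) ∈ X').card =
      (B.filter fun j => (((eA x : Fin n)), j) ∈ X ∧ (((eA x' : Fin n)), j) ∈ X).card := by
    intro x x'
    have := card_filter_transport B eB (fun j => (((eA x : Fin n)), j) ∈ X ∧ (((eA x' : Fin n)), j) ∈ X)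
    refine Eq.trans ?_ this
    congr 1; ext z; simp only [Finset.mem_filter, Finset.mem_univ, true_and, hX']
  let embA : Fin a ↪ Fin n := ⟨fun x => ((eA x : Fin n)), fun _ _ h => eA.injective (Subtype.ext h)⟩
  let embB : Fin a ↪ Fin n := ⟨fun y => ((eB y : Fin n)), fun _ _ h => eB.injective (Subtype.ext h)⟩
  have tRect : ∀ S T : Finset (Fin a), (X'.filter fun e => e.1 ∈ S ∧ e.2 ∈ T).card =
      (X.filter fun e => e.1 ∈ S.map embA ∧ e.2 ∈ T.map embB).card :=
    fun S T => rect_transport X A B eA eB X' hX' S T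
  have tCard : X'.card = (X.filter fun e => e.1 ∈ A ∧ e.2 ∈ B).card := by
    have h1 := tRect Finset.univ Finset.univ
    rw [map_univ_equiv A eA, map_univ_equiv B eB] at h1
    rw [← h1]
    congr 1; ext e; simp only [Finset.mem_filter, Finset.mem_univ, and_true]
  -- (6) density and regularity of X' on the `a`-board
  have hdensX' : a * a ≤ 2 * Dd * X'.card := by rw [tCard]; exact hdAB
  have hregX' : ∀ S T : Finset (Fin a), a ≤ P₄ * S.card → a ≤ P₄ * T.card →
      |(((X'.filter fun e => e.1 ∈ S ∧ e.2 ∈ T).card : ℕ) : ℝ) / ((S.card : ℝ) * (T.card : ℝ)) -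
        ((X'.card : ℕ) : ℝ) / ((a : ℝ) * (a : ℝ))| ≤ 1 / (P₄ : ℝ) := by
    intro S T hS hT
    have hS' : a ≤ (P₀ + P₄ + 1) * (S.map embA).card := by
      rw [Finset.card_map]; exact le_trans hS (Nat.mul_le_mul_right _ (by omega))
    have hT' : a ≤ (P₀ + P₄ + 1) * (T.map embB).card := by
      rw [Finset.card_map]; exact le_trans hT (Nat.mul_le_mul_right _ (by omega))
    have hSA : S.map embA ⊆ A := by
      intro i hi
      obtain ⟨x, -, rfl⟩ := Finset.mem_map.mp hi
      exact (eA x).2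
    have hTB : T.map embB ⊆ B := by
      intro j hj
      obtain ⟨y, -, rfl⟩ := Finset.mem_map.mp hj
      exact (eB y).2
    have h := hregAB (S.map embA) hSA (T.map embB) hTB hS' hT'
    rw [Finset.card_map, Finset.card_map, ← tRect S T, ← tCard] at h
    have hP4' : (1 : ℝ) / (((P₀ + P₄ + 1 : ℕ) : ℝ)) ≤ 1 / (P₄ : ℝ) := by
      apply div_le_div_of_nonneg_left zero_le_one (by exact_mod_cast hP₄)
      exact_mod_cast (show P₄ ≤ P₀ + P₄ + 1 by omega)
    exact le_trans h hP4'
  -- (7) the codegree deviations (H2)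
  obtain ⟨c₂, c₄, hc₂a, hsq, hdev₂, hdev₄, hc₄⟩ := hCD a ha₀ X' hdensX' hregX'
  -- a ≤ D₂ · c₂
  have hc₂ : a ≤ 64 * Dd ^ 2 * c₂ := by
    have haR : (0 : ℝ) < a := by exact_mod_cast ha1
    have hXc : (a : ℝ) * a ≤ 2 * Dd * (X'.card : ℕ) := by exact_mod_cast hdensX'
    have hDdR : (1 : ℝ) ≤ Dd := by exact_mod_cast hDd1
    -- a⁴ ≤ (2Dd)²·#X'² ≤ (2Dd)²·(c₂+1)·a³, so a ≤ 4Dd²(c₂+1)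
    have h1 : (a : ℝ) ≤ 4 * (Dd : ℝ) ^ 2 * ((c₂ : ℝ) + 1) := by
      have h2 : ((a : ℝ) * a) ^ 2 ≤ (2 * Dd * (X'.card : ℕ)) ^ 2 := by
        exact pow_le_pow_left₀ (by positivity) hXc 2
      have h3 : (2 * (Dd : ℝ) * (X'.card : ℕ)) ^ 2 = 4 * (Dd : ℝ) ^ 2 * ((X'.card : ℕ) : ℝ) ^ 2 := by ring
      rw [h3] at h2
      have h4 : 4 * (Dd : ℝ) ^ 2 * ((X'.card : ℕ) : ℝ) ^ 2 ≤ 4 * (Dd : ℝ) ^ 2 * (((c₂ : ℝ) + 1) * (a : ℝ) ^ 3) :=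
        mul_le_mul_of_nonneg_left hsq (by positivity)
      have h5 : ((a : ℝ) * a) ^ 2 = (a : ℝ) * (a : ℝ) ^ 3 := by ring
      rw [h5] at h2
      have h6 : (a : ℝ) * (a : ℝ) ^ 3 ≤ (4 * (Dd : ℝ) ^ 2 * ((c₂ : ℝ) + 1)) * (a : ℝ) ^ 3 := by
        linarith only [h2, h4]
      exact le_of_mul_le_mul_right h6 (by positivity)
    have hc₂1 : 1 ≤ c₂ := by
      by_contra h0
      push Not at h0
      have : c₂ = 0 := by omega
      rw [this] at h1
      have : (a : ℝ) ≤ 4 * (Dd : ℝ) ^ 2 := by simpa using h1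
      have : a ≤ 4 * Dd ^ 2 := by exact_mod_cast this
      omega
    have h7 : (a : ℝ) ≤ 64 * (Dd : ℝ) ^ 2 * c₂ := by
      have : (c₂ : ℝ) + 1 ≤ 2 * c₂ := by
        have : (1 : ℝ) ≤ c₂ := by exact_mod_cast hc₂1
        linarith
      nlinarith only [h1, this, hDdR]
    exact_mod_cast h7
  -- (8) the perfect matching through the block
  have has : a ≤ s := by
    have : a ≤ m := by rw [← hAa, ← hV]; exact Finset.card_le_card hAV
    omega
  obtain ⟨σ, hσG, hσAB, -⟩ := (MatchingGlue.stub_matchingGlue).1 n s G R C A B σ₀ g hσ₀G hσ₀sq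
    (by rw [hRnn]; exact hsnn)
    (by intro U hU hUne hUs; rw [hRnn] at hUs; exact hsur U hU hUne hUs)
    hAR hBC (by rw [hAa, hBa]) (by rw [hAa]; exact has)
    (fun x hx => ⟨(hg1 x hx).1, hXG _ (hg1 x hx).2⟩) hg2
  -- (9) assemble
  refine ⟨a, A, B, eA, eB, σ, X', c₂, c₄, ?_, hσG, hσAB, hX'G, ?_, ?_, hc₂, hc₂a, hdev₂, hdev₄, hc₄, ?_⟩
  · -- n ≤ 16·Mz·a
    calc n ≤ Mz * m := hnM
      _ ≤ Mz * (16 * a) := Nat.mul_le_mul_left _ hma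
      _ = 16 * Mz * a := by ring
  · intro x; rw [tRow]; exact h1r _ (eA x).2
  · intro y; rw [tCol]; exact h1c _ (eB y).2
  · intro x
    have h := h3 ((eA x : Fin n)) (eA x).2
    have e : (Finset.univ.filter fun y : Fin a => y ≠ x ∧
        (Finset.univ.filter fun z : Fin a => (x, z) ∈ X' ∧ (y, z) ∈ X').card < a / (64 * Dd ^ 2)).card =
        (A.filter fun x' => x' ≠ ((eA x : Fin n)) ∧
          (B.filter fun y => (((eA x : Fin n)), y) ∈ X ∧ (x', y) ∈ X).card < a / (64 * Dd ^ 2)).card := by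
      have := card_filter_transport A eA (fun x' => x' ≠ ((eA x : Fin n)) ∧
        (B.filter fun y => (((eA x : Fin n)), y) ∈ X ∧ (x', y) ∈ X).card < a / (64 * Dd ^ 2))
      refine Eq.trans ?_ this
      congr 1; ext y
      simp only [Finset.mem_filter, Finset.mem_univ, true_and, tCodeg]
      constructor
      · rintro ⟨hne, hlt⟩
        exact ⟨fun heq => hne (eA.injective (Subtype.ext heq)), hlt⟩
      · rintro ⟨hne, hlt⟩
        exact ⟨fun heq => hne (by rw [heq]), hlt⟩
    rw [e]; exact h

/-- **stub_quasiRandomSquareBlock — the EXTRACTION is a theorem (lead c9).**  Every rich host `G ⊆ [n]²` (`n! ≤ Kⁿ·#PM(G)`) has a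
linear σ-square block `A × B` (`σ ⊆ G` a perfect matching, `σ(B) = A`, `#A = a ≥ n/Cf`) whose transported host on the `a`-board
has minimum degrees `a/D₁` (H1), typical codegree `c₂ ∈ [a/D₂, a]` and 4-wise level `c₄` with `D₃`-small `ℓ¹` deviations (H2), and at
most `a/E` low-codegree partners per row (H3); `D₁, D₂` depend on `K` only, the precision `D₃, E` is arbitrary.  The registered stub
of `Cruxes/PerMultiplesHard/Lines/uncharged_face_walk.lean`, verbatim: `quasiRandomSquareBlock_of_richPiece` ∘ `RichPiece.stub_richPiece`.
With the tree's `stub_orderedFactor` and `richHost_of_squareBlock` it makes the rich-host complete-class rung unconditional. [folklore] -/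
theorem stub_quasiRandomSquareBlock :
    ∀ K : ℕ, 1 ≤ K → ∃ D₁ D₂ : ℕ, 1 ≤ D₁ ∧ 1 ≤ D₂ ∧ ∀ D₃ E : ℕ, 1 ≤ D₃ → 1 ≤ E →
      ∃ Cf n₀ : ℕ, 1 ≤ Cf ∧ ∀ n ≥ n₀, ∀ G : Finset (Fin n × Fin n),
      n.factorial ≤ K ^ n * ((Finset.univ : Finset (Equiv.Perm (Fin n))).filter (fun σ => ∀ i, (σ i, i) ∈ G)).card →
      ∃ (a : ℕ) (A B : Finset (Fin n)) (eA : Fin a ≃ {x // x ∈ A}) (eB : Fin a ≃ {x // x ∈ B})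
        (σ : Equiv.Perm (Fin n)) (X : Finset (Fin a × Fin a)) (c₂ c₄ : ℕ),
        n ≤ Cf * a ∧ (∀ i, (σ i, i) ∈ G) ∧ (∀ i, σ i ∈ A ↔ i ∈ B) ∧
        (∀ e : Fin a × Fin a, e ∈ X ↔ ((eA e.1 : Fin n), (eB e.2 : Fin n)) ∈ G) ∧
        (∀ x : Fin a, a ≤ D₁ * (Finset.univ.filter fun y : Fin a => (x, y) ∈ X).card) ∧
        (∀ y : Fin a, a ≤ D₁ * (Finset.univ.filter fun x : Fin a => (x, y) ∈ X).card) ∧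
        a ≤ D₂ * c₂ ∧ c₂ ≤ a ∧
        (D₃ : ℝ) * (∑ x : Fin a, ∑ x' ∈ Finset.univ.erase x,
            |(((Finset.univ.filter fun y : Fin a => (x, y) ∈ X ∧ (x', y) ∈ X).card : ℕ) : ℝ) - c₂|) ≤ (a : ℝ) ^ 3 ∧
        (D₃ : ℝ) * (∑ x₁ : Fin a, ∑ x₂ ∈ Finset.univ.erase x₁, ∑ x₃ ∈ (Finset.univ.erase x₁).erase x₂,
            ∑ x₄ ∈ ((Finset.univ.erase x₁).erase x₂).erase x₃,
            |(((Finset.univ.filter fun y : Fin a =>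
                (x₁, y) ∈ X ∧ (x₂, y) ∈ X ∧ (x₃, y) ∈ X ∧ (x₄, y) ∈ X).card : ℕ) : ℝ) - c₄|) ≤ (a : ℝ) ^ 5 ∧
        (D₃ : ℝ) * |(c₄ : ℝ) * a - (c₂ : ℝ) ^ 2| ≤ (a : ℝ) ^ 2 ∧
        (∀ x : Fin a, E * (Finset.univ.filter fun y : Fin a => y ≠ x ∧
            (Finset.univ.filter fun z : Fin a => (x, z) ∈ X ∧ (y, z) ∈ X).card < a / D₂).card ≤ a) :=
  quasiRandomSquareBlock_of_richPiece RichPiece.stub_richPiece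

end Summit.ValiantsHypothesis.ValiantsHypothesis.Theorems.DivisionGap.PerMultiplesHard.Extraction
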